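import Summits.BirchSwinnertonDyer.BirchSwinnertonDyer.Theorems.UniversalToricDescentRelaxedLayerTransportTorsion
import Summits.BirchSwinnertonDyer.BirchSwinnertonDyer.Theorems.AlignedTransportAtTwoMainConjectureOfRankZeroBSDAtTwoFineRoadInfResRel
import HarnessLib

/-!
# The pair `(Φ^M, Φ)` at level `p^k`: the level-`p^k` transport inside `E[p^∞]`, with BOTH place-wise dictionaries
# (crux ♭T≤ stmt-BirchSwinnertonDyer-23042, line `sigmacongruence`, stub R1 `stub_relaxedImageCount`, brick (b′) file 2)

Route `UniversalToricDescent`, lead prover `bsd-wall-utd-p1` g18. THEOREMS ONLY (no definition, no named fact, no `sorry`);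
`--supports stmt-BirchSwinnertonDyer-23042`. BSD is not proved by any of this.

For `K ⊆ L` number fields, `L/K` Galois, `U ≤ galRange L` normal with `res⁻¹(U) = Γ_L`, `E = W/K` elliptic, `p` prime, `k : ℕ`:
**`exists_transportTorsion_primary`** — the bijective level-`p^k` transport `Φ^M : H¹(Γ_L, E_L[p^k]) ≃ H¹(U, E[p^k])` of file 1
(`…RelaxedLayerTransportTorsion.exists_transportTorsion`, with its VANISHING dictionary «`loc_w z = 0` ∀ `w ∣ u`» ⟺ «`conj_σ (Φ^M z) ∈
awayKer U E[p^k] u` ∀σ») together with `Φ := (E[p^k] ↪ E[p^∞])_* ∘ Φ^M : H¹(Γ_L, E_L[p^k]) →+ H¹(U, E[p^∞])`, which coincides with the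
transport `subgroupH1Iso ∘ res_{⊤→res⁻¹U} ∘ (⊤ ↪ Γ_L)_* ∘ (E_L[p^k] ↪ E_L[p^∞])_*` of `…RelaxedLayerTransport` (maps of the same compatible
pair), and therefore has: the `E[p^∞]`-shadow of the vanishing dictionary (`loc_w z = 0` ∀ `w ∣ u` ⟹ `conj_σ (Φ z) ∈ awayKer U E[p^∞] u`),
`p^k`-torsion values, injectivity when `E_L[p^∞]^{Γ_L} = 0`, and the «Kummer at every `w ∣ u`» ⟺ «`conj_σ (Φ x)` classical at `u` ∀σ»
dictionary (proof as in `…RelaxedLayerTransport.exists_transport`).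

References: [GreenbergLNM1716] §2 (pp. 62–63), §3 Lemma 3.1; [SerreGaloisCohomology1997] I.§2.4–2.5, II.§1.1; [NeukirchANT1999] II.§8.
-/

set_option linter.dupNamespace false
set_option autoImplicit false

noncomputable section
open scoped Classical
open CategoryTheory Field NumberField IsDedekindDomain Function
open Literature.NumberTheory.EllipticCurves Literature.NumberTheory.EllipticCurves.GreenbergSelmer
open Literature.NumberTheory.GaloisRepresentations
open Literature.NumberTheory.GaloisCohomology
open scoped ContRepresentation
open scoped NumberField.LiesOver

namespace Summit.BirchSwinnertonDyer.BirchSwinnertonDyer.Theorems.UniversalToricDescentRelaxedLayerTransportTorsion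

open Summit.BirchSwinnertonDyer.Rank1Residual.X11b.KummerPT Summit.BirchSwinnertonDyer.Rank1Residual.X11b.LocBridge
  Summit.BirchSwinnertonDyer.Rank1Residual.X11b.Levels
  Summit.BirchSwinnertonDyer.BirchSwinnertonDyer.Theorems.SignedEC.RelaxedKummerCount
  Summit.BirchSwinnertonDyer.Rank1Residual.Additive Summit.BirchSwinnertonDyer.Rank1Residual.Additive.LocalTransport
  Summit.BirchSwinnertonDyer.Rank1Residual.Additive.BaseChange
  Summit.BirchSwinnertonDyer.BirchSwinnertonDyer.Theorems.EtaLayer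

/-! ## Change of coefficients preserves `awayKer` -/

section GenericAway

variable {K : Type} [Field K] [NumberField K]
  {M : Type} [AddCommGroup M] [DistribMulAction (absoluteGaloisGroup K) M] [TopologicalSpace M] [DiscreteTopology M]
  {N : Type} [AddCommGroup N] [DistribMulAction (absoluteGaloisGroup K) N] [TopologicalSpace N] [DiscreteTopology N]

/-- A `Γ_K`-equivariant change of coefficients maps `awayKer H M u` into `awayKer H N u`. [cite: GreenbergLNM1716, §2] -/
theorem resH1Hom_id_mem_awayKer (ψ : M →+ N) (hψ : ∀ (g : absoluteGaloisGroup K) (m : M), ψ (g • m) = g • ψ m)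
    (H : Subgroup (absoluteGaloisGroup K)) (u : HeightOneSpectrum (𝓞 K)) {c : subgroupH1 H M}
    (hc : c ∈ awayKer H M u) :
    resH1Hom (ContinuousMonoidHom.id H) ψ (fun x m ↦ hψ x m) c ∈ awayKer H N u := by
  rw [awayKer, AddMonoidHom.mem_ker] at hc ⊢
  rw [resOfLe_resH1Hom_id ψ hψ, hc, map_zero]

-- (restriction `H ≤ H'` maps `awayKer H' M u` into `awayKer H M u`: the tree's `AlignedTransportAtTwoFineRoad.InfResRel.resOfLe_mem_awayKer`)

end GenericAway

/-! ## The pair `(Φ^M, Φ)` at level `p^k` -/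

section Primary

variable {K : Type} [Field K] [NumberField K] (W : WeierstrassCurve K) [W.IsElliptic] (p k : ℕ) [Fact p.Prime]
  (L : Type) [Field L] [NumberField L] [Algebra K L] [IsGalois K L]
  {U : Subgroup (absoluteGaloisGroup K)} [U.Normal] (hU : U ≤ galRange (K := K) L)
  (hH : ∀ τ : absoluteGaloisGroup L, τ ∈ comapResGal L U)

include hU hH in
/-- **The pair `(Φ^M, Φ)` at level `p^k`.** `Φ^M : H¹(Γ_L, E_L[p^k]) ≃ H¹(U, E[p^k])` (§3) and
`Φ = (E[p^k] ↪ E[p^∞])_* ∘ Φ^M : H¹(Γ_L, E_L[p^k]) →+ H¹(U, E[p^∞])` — the transport of `…RelaxedLayerTransport`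
(`subgroupH1Iso ∘ res_{⊤→res⁻¹U} ∘ (⊤ ↪ Γ_L)_* ∘ (E_L[p^k] ↪ E_L[p^∞])_*`, the two composites are the maps of the same compatible pair) —
with: `Φ^M` bijective; the vanishing dictionary for `Φ^M` and its `E[p^∞]`-shadow for `Φ`; `p^k Φ = 0`; `Φ` injective when
`E_L[p^∞]^{Γ_L} = 0`; and the «Kummer at every `w ∣ u`» ⟺ «`conj_σ (Φ x)` classical at `u` ∀σ» dictionary.
[cite: GreenbergLNM1716, §2 (pp. 62–63), §3 Lemma 3.1] [cite: SerreGaloisCohomology1997, I.§2.4–2.5, II.§1.1] [cite: NeukirchANT1999, Ch. II §8] -/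
theorem exists_transportTorsion_primary :
    ∃ (ΦM : galoisCohomology ((W.baseChange L).torsionGaloisModule ((p ^ k : ℕ) : ℤ)) 1 →+
        subgroupH1 U (W.geomTorsion ((p ^ k : ℕ) : ℤ)))
      (Φ : galoisCohomology ((W.baseChange L).torsionGaloisModule ((p ^ k : ℕ) : ℤ)) 1 →+ W.subgroupH1 p U),
      Function.Bijective ΦM ∧
      (∀ z, Φ z = resH1Hom (ContinuousMonoidHom.id U)
          (AddSubgroup.inclusion (Literature.Barriers.BirchSwinnertonDyer.geomTorsion_pow_le_geomPrimaryTorsion W p k))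
          (fun _ _ ↦ rfl) (ΦM z)) ∧
      (∀ (u : HeightOneSpectrum (𝓞 K)) (z : galoisCohomology ((W.baseChange L).torsionGaloisModule ((p ^ k : ℕ) : ℤ)) 1),
        (∀ w : HeightOneSpectrum (𝓞 L), w.asIdeal.LiesOver u.asIdeal →
          galoisCohomology.localization ((W.baseChange L).torsionGaloisModule ((p ^ k : ℕ) : ℤ)) (Sum.inr w) 1 z = 0) ↔
        ∀ σ : absoluteGaloisGroup K,
          conjH1 U (W.geomTorsion ((p ^ k : ℕ) : ℤ)) σ (ΦM z) ∈ awayKer U (W.geomTorsion ((p ^ k : ℕ) : ℤ)) u) ∧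
      (∀ (u : HeightOneSpectrum (𝓞 K)) (z : galoisCohomology ((W.baseChange L).torsionGaloisModule ((p ^ k : ℕ) : ℤ)) 1),
        (∀ w : HeightOneSpectrum (𝓞 L), w.asIdeal.LiesOver u.asIdeal →
          galoisCohomology.localization ((W.baseChange L).torsionGaloisModule ((p ^ k : ℕ) : ℤ)) (Sum.inr w) 1 z = 0) →
        ∀ σ : absoluteGaloisGroup K, W.conjH1 p U σ (Φ z) ∈ awayKer U (W.geomPrimaryTorsion p) u) ∧
      (∀ x, p ^ k • Φ x = 0) ∧
      ((∀ m : (W.baseChange L).geomPrimaryTorsion p, (∀ σ : absoluteGaloisGroup L, σ • m = m) → m = 0) →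
        Function.Injective Φ) ∧
      ∀ (u : HeightOneSpectrum (𝓞 K)) (x : galoisCohomology ((W.baseChange L).torsionGaloisModule ((p ^ k : ℕ) : ℤ)) 1),
        (∀ w : HeightOneSpectrum (𝓞 L), w.asIdeal.LiesOver u.asIdeal →
          galoisCohomology.res ((W.baseChange L).torsionGaloisModule ((p ^ k : ℕ) : ℤ)) (w.adicCompletion L) 1 x ∈
            (W.baseChange L).kummerLocalConditionAt ((p ^ k : ℕ) : ℤ) (w.adicCompletion L)) ↔
        ∀ σ : absoluteGaloisGroup K, W.conjH1 p U σ (Φ x) ∈ W.localKerOver p U (u.adicCompletion K) := by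
  classical
  haveI : PerfectField K := PerfectField.ofCharZero
  haveI : PerfectField L := PerfectField.ofCharZero
  haveI : NeZero (p ^ k) := ⟨pow_ne_zero k (Fact.out : p.Prime).ne_zero⟩
  obtain ⟨ΦM, hbij, hformula, hdict⟩ := exists_transportTorsion W ((p ^ k : ℕ) : ℤ) L hU hH
  have hle : comapResGal L U ≤ ⊤ := le_top
  have hge : (⊤ : Subgroup (absoluteGaloisGroup L)) ≤ comapResGal L U := fun σ _ ↦ hH σ
  let ι₁ : galoisCohomology ((W.baseChange L).torsionGaloisModule ((p ^ k : ℕ) : ℤ)) 1 →+ (W.baseChange L).galH1Primary p :=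
    resH1Hom (ContinuousMonoidHom.id (absoluteGaloisGroup L))
      (AddSubgroup.inclusion (Literature.Barriers.BirchSwinnertonDyer.geomTorsion_pow_le_geomPrimaryTorsion (W.baseChange L) p k))
      (fun _ _ ↦ rfl)
  let ι₂ : (W.baseChange L).galH1Primary p →+ (W.baseChange L).subgroupH1 p ⊤ :=
    resH1Hom (Literature.NumberTheory.EllipticCurves.subgroupIncl (⊤ : Subgroup (absoluteGaloisGroup L)))
      (AddMonoidHom.id ((W.baseChange L).geomPrimaryTorsion p)) (fun _ _ ↦ rfl)
  let ι₃ : (W.baseChange L).subgroupH1 p ⊤ →+ (W.baseChange L).subgroupH1 p (comapResGal L U) := (W.baseChange L).resOfLe p hle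
  let Ψ := subgroupH1Iso L W p hU
  let Φ : galoisCohomology ((W.baseChange L).torsionGaloisModule ((p ^ k : ℕ) : ℤ)) 1 →+ W.subgroupH1 p U :=
    Ψ.toAddMonoidHom.comp (ι₃.comp (ι₂.comp ι₁))
  have hΦ : ∀ x, Φ x = Ψ (ι₃ (ι₂ (ι₁ x))) := fun _ ↦ rfl
  have hι₂ : Function.Injective ι₂ := (bijective_resH1Hom_subgroupIncl _ ⊤ Subgroup.mem_top).1
  have hι₃ : Function.Injective ι₃ := resOfLe_injective_of_ge ((W.baseChange L).geomPrimaryTorsion p) hle hge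
  -- the coefficient identity `(E[p^∞] ≃ E_L[p^∞])⁻¹ ∘ (E_L[p^k] ↪ E_L[p^∞]) = (E[p^k] ↪ E[p^∞]) ∘ (E[p^k] ≃ E_L[p^k])⁻¹`
  have hcoef : ∀ Q : (W.baseChange L).geomTorsion ((p ^ k : ℕ) : ℤ),
      (primaryBaseChangeEquiv L W p).symm
          (AddSubgroup.inclusion (Literature.Barriers.BirchSwinnertonDyer.geomTorsion_pow_le_geomPrimaryTorsion (W.baseChange L) p k) Q) =
        AddSubgroup.inclusion (Literature.Barriers.BirchSwinnertonDyer.geomTorsion_pow_le_geomPrimaryTorsion W p k)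
          ((torsionBaseChangeEquiv L W ((p ^ k : ℕ) : ℤ)).symm Q) := by
    intro Q
    apply (primaryBaseChangeEquiv L W p).injective
    rw [AddEquiv.apply_symm_apply]
    conv_lhs => rw [← (torsionBaseChangeEquiv L W ((p ^ k : ℕ) : ℤ)).apply_symm_apply Q]
    exact Subtype.ext rfl
  -- `Φ = (E[p^k] ↪ E[p^∞])_* ∘ Φ^M`
  have hΦM : ∀ z, Φ z = resH1Hom (ContinuousMonoidHom.id U)
      (AddSubgroup.inclusion (Literature.Barriers.BirchSwinnertonDyer.geomTorsion_pow_le_geomPrimaryTorsion W p k))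
      (fun _ _ ↦ rfl) (ΦM z) := by
    intro z
    rw [hformula z, hΦ]
    change resH1Hom (subgroupToComap L hU) (primaryBaseChangeEquiv L W p).symm.toAddMonoidHom
        (primaryBaseChangeEquiv_symm_subgroupToComap_smul L W p hU) (resH1Hom _ _ _ (resH1Hom _ _ _ (resH1Hom _ _ _ z))) = _
    rw [resH1Hom_resH1Hom, resH1Hom_resH1Hom, resH1Hom_resH1Hom, resH1Hom_resH1Hom]
    exact DFunLike.congr_fun (resH1Hom_congr (ContinuousMonoidHom.ext fun _ ↦ rfl) (AddMonoidHom.ext fun Q ↦ hcoef Q) _ _) z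
  refine ⟨ΦM, Φ, hbij, hΦM, hdict, fun u z hz σ ↦ ?_, fun x ↦ ?_, fun hfix ↦ ?_, fun u x ↦ ?_⟩
  · -- the `E[p^∞]`-shadow of the vanishing dictionary
    rw [hΦM z, conjH1_resH1Hom_id _ (fun _ _ ↦ rfl)]
    exact resH1Hom_id_mem_awayKer _ (fun _ _ ↦ rfl) U u ((hdict u z).mp hz σ)
  · -- `p^k`-torsion
    have hx0 : p ^ k • x = 0 :=
      nsmul_continuousCohomology_one_eq_zero _ (p ^ k)
        (fun T : (W.baseChange L).geomTorsion ((p ^ k : ℕ) : ℤ) ↦ AddSubgroup.torsionBy.nsmul T) x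
    rw [← map_nsmul, hx0, map_zero]
  · -- injectivity
    have hι₁ : Function.Injective ι₁ := by
      obtain ⟨hkerfin, hkerle⟩ := finite_ker_resH1Hom_inclusion_and_natCard_le (W.baseChange L) p k
      haveI : Finite ι₁.ker := hkerfin
      have hfix1 : Nat.card {m : (W.baseChange L).geomPrimaryTorsion p | ∀ σ : absoluteGaloisGroup L, σ • m = m} = 1 := by
        rw [Nat.card_eq_one_iff_unique]
        refine ⟨⟨fun a b ↦ Subtype.ext ((hfix a.1 a.2).trans (hfix b.1 b.2).symm)⟩, ⟨⟨0, fun σ ↦ smul_zero σ⟩⟩⟩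
      have hker1 : Nat.card ι₁.ker ≤ 1 := by
        have h := hkerle
        rw [hfix1] at h
        exact h
      rw [injective_iff_map_eq_zero]
      intro x hx
      have hmem : x ∈ ι₁.ker := (AddMonoidHom.mem_ker).mpr hx
      have hsub : Subsingleton ι₁.ker := Finite.card_le_one_iff_subsingleton.mp hker1
      have := hsub.elim ⟨x, hmem⟩ ⟨0, ι₁.ker.zero_mem⟩
      exact congrArg Subtype.val this
    intro x y hxy
    rw [hΦ, hΦ] at hxy
    exact hι₁ (hι₂ (hι₃ (Ψ.injective hxy)))
  · -- the Kummer / classical dictionary at `u` (as in `…RelaxedLayerTransport.exists_transport`)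
    have hsame : ∀ w : HeightOneSpectrum (𝓞 L),
        galoisCohomology.res ((W.baseChange L).torsionGaloisModule ((p ^ k : ℕ) : ℤ)) (w.adicCompletion L) 1 x ∈
            (W.baseChange L).kummerLocalConditionAt ((p ^ k : ℕ) : ℤ) (w.adicCompletion L) ↔
          ι₃ (ι₂ (ι₁ x)) ∈ (W.baseChange L).localKerOver p (comapResGal L U) (w.adicCompletion L) := by
      intro w
      have h1 : galoisCohomology.res ((W.baseChange L).torsionGaloisModule ((p ^ k : ℕ) : ℤ)) (w.adicCompletion L) 1 x ∈
            (W.baseChange L).kummerLocalConditionAt ((p ^ k : ℕ) : ℤ) (w.adicCompletion L) ↔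
          x ∈ WeierstrassCurve.selmerLocalKer (W.baseChange L) (w.adicCompletion L) ((p ^ k : ℕ) : ℤ) := by
        rw [← (W.baseChange L).comap_res_kummerLocalConditionAt ((p ^ k : ℕ) : ℤ) (w.adicCompletion L)]
        exact Iff.rfl
      have h2 : ι₁ x ∈ WeierstrassCurve.selmerLocalKerPrimary (W.baseChange L) (w.adicCompletion L) p ↔
          x ∈ WeierstrassCurve.selmerLocalKer (W.baseChange L) (w.adicCompletion L) ((p ^ k : ℕ) : ℤ) := by
        refine ⟨fun h' ↦ ?_, fun h ↦ resH1Hom_inclusion_mem_selmerLocalKerPrimary (W.baseChange L) p k (w.adicCompletion L) h⟩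
        have h : resH1Hom (ContinuousMonoidHom.id (absoluteGaloisGroup L))
            (AddSubgroup.inclusion
              (Literature.Barriers.BirchSwinnertonDyer.geomTorsion_pow_le_geomPrimaryTorsion (W.baseChange L) p k))
            (fun _ _ ↦ rfl) x ∈ WeierstrassCurve.selmerLocalKerPrimary (W.baseChange L) (w.adicCompletion L) p := h'
        rw [WeierstrassCurve.mem_selmerLocalKerPrimary_iff, ← AddMonoidHom.comp_apply, resH1Hom_comp] at h
        unfold WeierstrassCurve.selmerLocalKer
        rw [resKer_eq_ker]
        refine (AddMonoidHom.mem_ker).mpr ?_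
        rw [← h]
        exact (DFunLike.congr_fun (resH1Hom_congr (by ext; rfl) (by ext; rfl) _ _) x).symm
      have h3 : ι₂ (ι₁ x) ∈ (W.baseChange L).localKerOver p ⊤ (w.adicCompletion L) ↔
          ι₁ x ∈ WeierstrassCurve.selmerLocalKerPrimary (W.baseChange L) (w.adicCompletion L) p :=
        WeierstrassCurve.resH1Hom_subgroupIncl_mem_localKerOver_top_iff (W.baseChange L) p (ι₁ x)
      refine h1.trans (h2.symm.trans (h3.symm.trans ?_))
      constructor
      · intro h; exact (W.baseChange L).resOfLe_mem_localKerOver p _ hle h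
      · intro h
        rw [WeierstrassCurve.localKerOver_eq_ofEmb, WeierstrassCurve.localKerOverOfEmb, AddMonoidHom.mem_ker] at h ⊢
        have e := (W.baseChange L).localResOverOfEmb_resOfLe p (closureEmb (K := L) (w.adicCompletion L)) hle (ι₂ (ι₁ x))
        change (W.baseChange L).localResOverOfEmb p (comapResGal L U) _ (ι₃ (ι₂ (ι₁ x))) = _ at e
        rw [e] at h
        have hinj := resOfLe_injective_of_ge (localPoints (W.baseChange L) (w.adicCompletion L))
          (Subgroup.comap_mono hle :
            localSubgroupOfEmb (comapResGal L U) (closureEmb (K := L) (w.adicCompletion L)) ≤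
              localSubgroupOfEmb ⊤ (closureEmb (K := L) (w.adicCompletion L)))
          (Subgroup.comap_mono hge)
        exact hinj (h.trans (map_zero _).symm)
    have hconj : ∀ τ : absoluteGaloisGroup L, (W.baseChange L).conjH1 p (comapResGal L U) τ (ι₃ (ι₂ (ι₁ x))) = ι₃ (ι₂ (ι₁ x)) :=
      fun τ ↦ by rw [(W.baseChange L).conjH1_of_mem_holds p (comapResGal L U) (hH τ), AddMonoidHom.id_apply]
    constructor
    · intro hx σ
      rw [hΦ]
      refine conjH1_subgroupH1Iso_mem_localKerOver_adicCompletion W p L hU u (ι₃ (ι₂ (ι₁ x))) ?_ σ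
      intro w hw τ
      rw [hconj]
      exact (hsame w).mp (hx w hw)
    · intro hσ w hw
      haveI := hw
      rw [hsame w, WeierstrassCurve.localKerOver_eq_ofEmb]
      obtain ⟨ι, ι₂', hcompat, hf, hfixL⟩ :=
        exists_package_adicCompletion_of_embedding L u (RingEquiv.refl _) (fun _ ↦ rfl) w
          (closureEmb (K := L) (w.adicCompletion L))
      rw [← subgroupH1Iso_mem_localKerOverOfEmb_iff L ι ι₂' (closureEmb (K := L) (w.adicCompletion L)) hcompat
        ((adicCompletionMap (K := K) L u w).comp (RingEquiv.refl (u.adicCompletion K)).symm.toRingHom)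
        hf W p hU (fun h hh ↦ hfixL h (hU hh)) (ι₃ (ι₂ (ι₁ x)))]
      obtain ⟨τ, rfl⟩ := exists_algHom_eq_comp (closureEmb (K := K) (u.adicCompletion K)) ι
      rw [WeierstrassCurve.localKerOverOfEmb_comp, AddSubgroup.mem_comap, ← WeierstrassCurve.localKerOver_eq_ofEmb]
      have h := hσ τ
      rw [hΦ] at h
      exact h

end Primary

end Summit.BirchSwinnertonDyer.BirchSwinnertonDyer.Theorems.UniversalToricDescentRelaxedLayerTransportTorsion

end
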